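import Literature.IUT.HodgeTheaters.CoveringsErrataE2Characterization
import Literature.IUT.HodgeTheaters.CoveringsErrataE2Negative
import Literature.IUT.HodgeTheaters.ThetaGeometryInhabited
import Literature.IUT.HodgeTheaters.InitialThetaDataTorsionCuspModelGeometry
import Literature.NumberTheory.GaloisRepresentations.AbsGaloisGroup
import Mathlib.NumberTheory.Padics.PadicNumbers
import HarnessLib

/-!
# [IUTchI] Remark 2.5.3 (ii) (E2) (`Rmk253.TameGaloisCountable`, FACT-LIST row F-1979): BINDER-FREE instance
# forms at a GENUINE MLF carrier and at the tree's model extensions (proof-only)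

S. Mochizuki, *Inter-universal Teichmüller theory I*, kurims manuscript (May 2020), §2, Remark 2.5.3 (ii) (E2)
p. 53: "if `k` is a field whose absolute Galois group is Galois-countable, and `U` is a nonempty open subscheme of a
connected proper `k`-scheme `X` that arises as the underlying scheme of a log scheme that is log smooth over `k` …,
and whose interior is equal to `U`, then the tamely ramified arithmetic fundamental group of `U` … is itself
Galois-countable [cf., e.g., [AbsTopI], Proposition 2.2]" [cite: Mochizuki2012, IUTchI Rmk 2.5.3 (ii) (E2) p.53]
(D-0012 claim key; series status DISPUTED; the content used here is point-set topology of profinite groups; no side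
taken).  abc-iut cell, block F, KEY INST59L1 (seat abc-iut-f-186 gen 3), FACT-LIST row **F-1979**.

abc-iut-L5-t6 typed (E2) MODEL-RELATIVELY as the predicate `Rmk253.TameGaloisCountable E` ("`G` Galois-countable ⇒
`Π` Galois-countable") on abc-iut-L4-t1's abstract extensions `E = (1 → Δ → Π → G → 1) : FundamentalExtension`.
Kernel status before this file (plan/LF-KERNEL-STATUS.tsv 2026-08-27T12:11Z): universal closure REFUTED
(`not_forall_tameGaloisCountable`, `not_tameGaloisCountable_pow`: `Δ` an uncountable power of `ℤ/2`) · conditional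
closers (`tameGaloisCountable_of_geomTFG`, `…_of_secondCountable_geom`, …) · exact failure set
(`not_tameGaloisCountable_iff`: `G` Galois-countable and `Δ` not) · NO theorem whose HEAD is the row at a closed
extension.  The row is consumed BY NAME at `D.geom.extF` (`D : InitialThetaData`; Cor 5.3 (ii) GOOD slot p513350,
`secondCountableTopology_PiC_of_tameGaloisCountable`), whose `Δ_{C_F}` is abstract — no closed instance can reach it.
PROOF-ONLY companion (no `def`, no `instance`, nothing re-typed); this file records closed-head instances at:

* **a GENUINE MLF carrier, zero-dimensional case** — `tameGaloisCountable_self G` / `tameGaloisCountable_self_padic p`: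
  the extension `Π = G`, `aug = id` (`Δ = 1`), at `G := G_{ℚ_p}` = Mathlib's `Field.absoluteGaloisGroup ℚ_[p]`
  (compact: abc-iut/Mathlib `Field.absoluteGaloisGroup.instCompactSpace`, char 0).  This IS print's (E2) at
  `U = X = Spec k` (a connected proper log-smooth `k`-log-scheme with trivial log structure and interior `U`;
  `π₁^tame(Spec k) = G_k`), `k = ℚ_p` — HONEST LABEL «genuine carrier, degenerate geometry `Δ = 1`»; the
  one-dimensional genuine case (a hyperbolic curve over `ℚ_p`) has no producer of `Π` in the tree;
* **the tree's MODEL extensions** (finite synthetic `Δ`; HONEST LABEL «model, not a tame fundamental group») —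
  `tameGaloisCountable_thetaGeometryModel_extOf G l` (abc-iut-L5's `ThetaGeometryModel.extOf G l = (G × (ℤ/2 × ℤ/l) ↠ G)`,
  [IUTchI] Def 3.1 (b) model, any profinite `G`), its closed MLF specialisation
  `tameGaloisCountable_thetaGeometryModel_extOf_padic p l` (`G := G_{ℚ_p}`), and
  `tameGaloisCountable_torsionCuspModel_ext F E F̄ l` (abc-iut-L5-t8's `TorsionCuspModel.ext`:
  `Π_{C_F} := (𝔽_l[E_F[l]] ⋊ E_F[l]) ⋊ (G_F × {±1}) ↠ G_F` over a field `F` with Galois `F̄/F` and an elliptic curve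
  `E/F` — the `E[l]`-twisted finite-shadow model whose `G_F`-part IS genuine);
* `tameGaloisCountable_regeom₃_extF D₀` — the CONSUMER-SHAPED instance: the cone binds the row as
  `Rmk253.TameGaloisCountable D.geom.extF` (`D : InitialThetaData`); for EVERY initial Θ-datum `D₀` the model
  re-geometrisation `D := D₀.regeom₃` (abc-iut-L5-t8, `InitialThetaDataTorsionCuspModelGeometry.lean`: `D₀` with its
  `π₁`-interface replaced by the `E[l]`-twisted finite-shadow model, `extF := TorsionCuspModel.ext F E F̄ l`) satisfies
  it — one binder `D₀` (the cell's standing datum type; its kernel inhabitation is the L5 programme's business, not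
  certified here), no hypothesis; HONEST LABEL «model `Δ_{C_F}`»;
* `tameGaloisCountable_decided` — the schema decided both ways in one universe.

Mechanism in every case: a finite (hence second countable, `Finite.toSecondCountableTopology`) synthetic factor, products
and induced topologies preserve second countability.  An instance-form theorem about OUR typed predicate at OUR
carriers ≠ the printed (E2); typed ≠ proved; refuted-as-typed (closure) ≠ refuted-in-print; nothing here bears on
[IUTchIII] Cor. 3.12 or asserts anything about abc.
-/

noncomputable section

namespace Literature.IUT.HodgeTheaters.Rmk253

open Literature.AnabelianGeometry.AbsoluteAnabelian (FundamentalExtension)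
open Topology

universe u

/-! ### The identity extension `Π = G` (print's `U = X = Spec k`) -/

/-- **(E2) at the identity extension `1 → 1 → G → G → 1`** (the case `U = X = Spec k` of the printed sentence:
`π₁^tame(Spec k) = G_k`), for every profinite `G`: `TameGaloisCountable ⟨G, G, id, _⟩` — tautologically.
Instance form of F-1979 with one binder (`G`), no hypothesis. [cite: Mochizuki2012, IUTchI Rmk 2.5.3 (ii) (E2) p.53] -/
theorem tameGaloisCountable_self (G : ProfiniteGrp.{u}) :
    Literature.IUT.HodgeTheaters.Rmk253.TameGaloisCountable
      ⟨G, G, ContinuousMonoidHom.id G, Function.surjective_id⟩ :=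
  fun h => h

/-- **(E2) at a GENUINE MLF carrier — instance form of F-1979, closed head, no hypothesis**: for every prime `p`, the
identity extension of the absolute Galois group `G_{ℚ_p}` of the `p`-adic field `ℚ_p` (Mathlib's
`Field.absoluteGaloisGroup ℚ_[p]` with the Krull topology — compact Hausdorff totally disconnected) satisfies
`TameGaloisCountable`.  HONEST LABEL: genuine carrier, zero-dimensional geometry (`X = Spec ℚ_p`, `Δ = 1`).
[cite: Mochizuki2012, IUTchI Rmk 2.5.3 (ii) (E2) p.53] -/
theorem tameGaloisCountable_self_padic (p : ℕ) [Fact p.Prime] :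
    Literature.IUT.HodgeTheaters.Rmk253.TameGaloisCountable
      ⟨ProfiniteGrp.of (Field.absoluteGaloisGroup ℚ_[p]), ProfiniteGrp.of (Field.absoluteGaloisGroup ℚ_[p]),
        ContinuousMonoidHom.id _, Function.surjective_id⟩ :=
  tameGaloisCountable_self _

/-- The closed instance at `p = 2`: no binder at all. [cite: Mochizuki2012, IUTchI Rmk 2.5.3 (ii) (E2) p.53] -/
theorem tameGaloisCountable_self_twoAdic :
    haveI : Fact (Nat.Prime 2) := ⟨Nat.prime_two⟩
    Literature.IUT.HodgeTheaters.Rmk253.TameGaloisCountable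
      ⟨ProfiniteGrp.of (Field.absoluteGaloisGroup ℚ_[2]), ProfiniteGrp.of (Field.absoluteGaloisGroup ℚ_[2]),
        ContinuousMonoidHom.id _, Function.surjective_id⟩ :=
  haveI : Fact (Nat.Prime 2) := ⟨Nat.prime_two⟩
  tameGaloisCountable_self_padic 2

/-! ### The tree's model extensions with finite synthetic `Δ` -/

/-- **(E2) at abc-iut-L5's model extension `ThetaGeometryModel.extOf G l = (G × (ℤ/2 × ℤ/l) ↠ G)`** ([IUTchI] Def.
3.1 (b) model `Π_C ↠ G_k` with `Δ_C := ℤ/2 × ℤ/l`), for every profinite `G` and `l ≠ 0`: `G` second countable ⇒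
`G × (ℤ/2 × ℤ/l)` second countable (finite discrete factor).  HONEST LABEL: model `Δ`, not a tame fundamental group.
[cite: Mochizuki2012, IUTchI Rmk 2.5.3 (ii) (E2) p.53] -/
theorem tameGaloisCountable_thetaGeometryModel_extOf (G : Type u) [Group G] [TopologicalSpace G]
    [IsTopologicalGroup G] [CompactSpace G] [TotallyDisconnectedSpace G] (l : ℕ) [NeZero l] :
    Literature.IUT.HodgeTheaters.Rmk253.TameGaloisCountable (ThetaGeometryModel.extOf G l) := by
  intro h
  haveI : SecondCountableTopology G := h
  exact (inferInstance : SecondCountableTopology (G × ThetaGeometryModel.Fac l))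

/-- **(E2) at the model extension over a GENUINE MLF Galois group** `G_{ℚ_p} × (ℤ/2 × ℤ/l) ↠ G_{ℚ_p}` — closed head for
each prime `p` and `l ≠ 0`. HONEST LABEL: genuine `G`, model `Δ`. [cite: Mochizuki2012, IUTchI Rmk 2.5.3 (ii) (E2) p.53] -/
theorem tameGaloisCountable_thetaGeometryModel_extOf_padic (p : ℕ) [Fact p.Prime] (l : ℕ) [NeZero l] :
    Literature.IUT.HodgeTheaters.Rmk253.TameGaloisCountable
      (ThetaGeometryModel.extOf (Field.absoluteGaloisGroup ℚ_[p]) l) :=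
  tameGaloisCountable_thetaGeometryModel_extOf _ l

/-- **(E2) at abc-iut-L5-t8's `E[l]`-twisted finite-shadow model** `TorsionCuspModel.ext F E F̄ l`
(`Π_{C_F} := (𝔽_l[E_F[l](F̄)] ⋊ E_F[l](F̄)) ⋊ (G_F × {±1}) ↠ G_F`, [IUTchI] Def. 3.1 (b)–(d) model; the quotient
`G_F = Gal(F̄/F)` and the `G_F`-module `E_F[l](F̄)` are the curve's, the rest synthetic): `G_F` second countable ⇒
`Π_{C_F}` second countable (the topology of `Π_{C_F}` is induced along `g ↦ (g.left, g.right)` into the product of a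
finite discrete group with `G_F × {±1}`).  HONEST LABEL: model. [cite: Mochizuki2012, IUTchI Rmk 2.5.3 (ii) (E2) p.53] -/
theorem tameGaloisCountable_torsionCuspModel_ext {F : Type u} [Field F] (E : WeierstrassCurve F) (Fbar : Type u)
    [Field Fbar] [Algebra F Fbar] (l : ℕ) [IsGalois F Fbar] [E.IsElliptic] [NeZero l] :
    Literature.IUT.HodgeTheaters.Rmk253.TameGaloisCountable (TorsionCuspModel.ext F E Fbar l) := by
  intro h
  haveI : SecondCountableTopology (Fbar ≃ₐ[F] Fbar) := h
  haveI : SecondCountableTopology (TorsionCuspModel.Del E Fbar l × TorsionMonodromyModel.GalPM F Fbar) :=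
    inferInstance
  exact (TorsionCuspModel.PiC.isInducing F E Fbar l).secondCountableTopology

/-- **(E2) in the CONSUMER'S SHAPE `TameGaloisCountable D.geom.extF`, at `D := D₀.regeom₃` for EVERY initial
Θ-datum `D₀`** (abc-iut-L5-t2's `InitialThetaData F K F̄ E l Pb`; abc-iut-L5-t8's model re-geometrisation `regeom₃`,
whose `π₁`-interface is the `E[l]`-twisted finite-shadow model `Π_{C_F} ↠ G_F = Gal(F̄/F)`): the binder the Cor 5.3 (ii)
GOOD-slot chain consumes BY NAME (`secondCountableTopology_PiC_of_tameGaloisCountable`, p513350 lineage) is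
DISCHARGED at the model datum.  One binder (`D₀`), no hypothesis.  HONEST LABEL: model `Δ_{C_F}`; at a GENUINE
`D.geom` (tame fundamental group of the hyperbolic orbicurve `C_F`) the row stays a named hypothesis (no producer of
`Π_{C_F}` in the tree). [cite: Mochizuki2012, IUTchI Rmk 2.5.3 (ii) (E2) p.53] -/
theorem tameGaloisCountable_regeom₃_extF {F K Fbar : Type u} [Field F] [NumberField F] [Field K] [NumberField K]
    [Algebra F K] [Field Fbar] [Algebra F Fbar] [Algebra K Fbar] {E : WeierstrassCurve F} [E.IsElliptic] {l : ℕ}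
    {Pb : BadPlacePredicates K} (D₀ : InitialThetaData F K Fbar E l Pb) :
    Literature.IUT.HodgeTheaters.Rmk253.TameGaloisCountable D₀.regeom₃.geom.extF := by
  intro h
  haveI := D₀.isAlgClosure
  haveI := D₀.isScalarTower
  haveI : NeZero l := ⟨D₀.l_prime.ne_zero⟩
  haveI : SecondCountableTopology (Fbar ≃ₐ[F] Fbar) := h
  haveI : SecondCountableTopology (TorsionCuspModel.Del E Fbar l × TorsionMonodromyModel.GalPM F Fbar) :=
    inferInstance
  exact (TorsionCuspModel.PiC.isInducing F E Fbar l).secondCountableTopology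

/-! ### The schema decided both ways -/

/-- **F-1979 decided both ways in one universe**: the predicate HOLDS at a closed extension with a genuine MLF
carrier (`G_{ℚ_2}`, identity extension) and its universal closure FAILS (`not_forall_tameGaloisCountable`,
abc-iut-f-187: `Δ` an uncountable power of `ℤ/2`). [cite: Mochizuki2012, IUTchI Rmk 2.5.3 (ii) (E2) p.53] -/
theorem tameGaloisCountable_decided :
    (∃ E : FundamentalExtension.{0}, TameGaloisCountable E) ∧
      ¬ ∀ E : FundamentalExtension.{0}, TameGaloisCountable E :=
  ⟨⟨_, tameGaloisCountable_self_twoAdic⟩, not_forall_tameGaloisCountable⟩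

end Literature.IUT.HodgeTheaters.Rmk253

end
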